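import Literature.Geometry.Lorentzian.SpacetimePositiveMassRigidityReductionBounded
import Literature.Geometry.Lorentzian.KIDSimplyConnected
import Literature.Geometry.Lorentzian.AFEndFarLoops
import HarnessLib

/-!
# The rigid positive energy theorem reduces to its analytic half

Final assembly of the geometric half of the proof of the rigid positive energy theorem
(Beig–Chruściel, J. Math. Phys. 37 (1996) 1939–1961, Thm. 4.1, case `m = 0`; the named fact
`positive_mass_rigidity_spacetime`, `SpacetimePositiveMassRigidity.lean`). The reduction
`positive_mass_rigidity_spacetime_of_kids_bounded` (`…ReductionBounded.lean`) left two inputs: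
(A′) the analytic half — global smooth translational Killing initial data `(N_a, Y_a)` with
Gram matrix `η`, `N₀ > 0` and `N₀` bounded (Witten's equation with `m = 0`, App. A) — and (SC)
the simple connectivity of `Σ`. Here (SC) is DISCHARGED from (A′) itself: the data of the
theorem are complete (`AFEnd.isComplete_of_isAsymptoticallyFlat_of_isSoleEnd`), far out in the
end there are loop-trivial regions containing balls of every radius
(`AFEnd.exists_far_loopTrivial_ball`, `AFEndFarLoops.lean`), so complete data carrying the KIDs
of (A′) are simply connected by the universal-cover/deck-translation argument
(`InitialDataSet.simplyConnectedSpace_of_kids_of_far_balls`, `KIDSimplyConnected.lean`).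

* `positive_mass_rigidity_spacetime_of_translationalKIDs` — **the named fact follows from its
  analytic half (A′) alone.**

What remains of Thm. 4.1 in the tree is therefore exactly Beig–Chruściel 1996, App. A (with
Witten 1981 / Parker–Taubes 1982): from `m = 0` (and the dominant energy condition, asymptotic
flatness, source decay) to four global translational KIDs with Minkowskian Gram matrix and
bounded lapse — spinor bundles, the Sen–Witten operator and weighted elliptic theory on an
asymptotically flat end, for which the tree has no carrier yet. Theorems only; no definitions,
no named facts (the input is a binder).

## References

* R. Beig, P. T. Chruściel, *Killing vectors in asymptotically flat space-times. I.
  Asymptotically translational Killing vectors and the rigid positive energy theorem*, J. Math.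
  Phys. 37 (1996) 1939–1961, arXiv:gr-qc/9510015: Thm. 4.1, its proof (§4) and App. A.
  [BeigChrusciel1996]
* E. Witten, Comm. Math. Phys. 80 (1981) 381–402; T. Parker, C. H. Taubes, Comm. Math. Phys.
  84 (1982) 223–238. [Witten1981]
-/

noncomputable section

open Bundle Set Function Manifold
open scoped Manifold ContDiff Topology

namespace Literature.Geometry.Lorentzian

/-- **The rigid positive energy theorem from its analytic half.** Granted that data
satisfying the hypotheses of `positive_mass_rigidity_spacetime` (dominant energy condition,
asymptotic flatness of order `1`, source decay, sole end, `E_ADM = 0`) carry global smooth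
translational Killing initial data `(N_a, Y_a)_{a<4}` — `h(∇ᵥY_a, w) = −N_a k(v, w)`,
`dN_a(v) = −k(v, Y_a)`, `−N_a N_b + h(Y_a, Y_b) = η_{ab}`, `N₀ > 0`, `N₀` bounded above
(Beig–Chruściel 1996, App. A with Witten's equation; the asymptotics of the Sen-parallel spinor)
— the named fact holds: such data are complete
(`AFEnd.isComplete_of_isAsymptoticallyFlat_of_isSoleEnd`) and simply connected
(`InitialDataSet.simplyConnectedSpace_of_kids_of_far_balls` with
`AFEnd.exists_far_loopTrivial_ball`), so `positive_mass_rigidity_spacetime_of_kids_bounded`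
applies. [cite: BeigChrusciel1996, Thm. 4.1 and its proof, §4 and App. A] -/
theorem positive_mass_rigidity_spacetime_of_translationalKIDs
    (hA : ∀ (X : Type) [TopologicalSpace X] [ChartedSpace E3 X] [IsManifold (𝓡 3) ∞ X]
      [T2Space X] [SecondCountableTopology X] [ConnectedSpace X]
      (D : InitialDataSet (𝓡 3) X) [D.metric.HasLeviCivita] (e : AFEnd X),
      D.SatisfiesDominantEnergyCondition → e.IsAsymptoticallyFlat D 1 →
      (∃ q₀, HasSourceDecay e D q₀) → e.IsSoleEnd → e.HasADMEnergy D 0 →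
      ∃ (N : Fin 4 → X → ℝ) (Y : Fin 4 → Π x : X, TangentSpace (𝓡 3) x),
        (∀ a, ContMDiff (𝓡 3) 𝓘(ℝ, ℝ) ∞ (N a)) ∧
        (∀ a, ContMDiff (𝓡 3) ((𝓡 3).prod (𝓡 3)) ∞
          fun x ↦ (TotalSpace.mk' E3 x (Y a x) : TangentBundle (𝓡 3) X)) ∧
        (∀ a (x : X) (v w : TangentSpace (𝓡 3) x),
          D.metric.val x (D.metric.leviCivita (Y a) x v) w = -(N a x * D.k x v w)) ∧
        (∀ a (x : X) (v : TangentSpace (𝓡 3) x),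
          mvfderiv (𝓡 3) (N a) x v = -(D.k x v (Y a x))) ∧
        (∀ (x : X) a b, -(N a x * N b x) + D.h.inner x (Y a x) (Y b x) =
          if a = b then (if a = 0 then -1 else 1) else 0) ∧
        (∀ x, 0 < N 0 x) ∧ ∃ C : ℝ, ∀ x, N 0 x ≤ C) :
    positive_mass_rigidity_spacetime := by
  refine positive_mass_rigidity_spacetime_of_kids_bounded hA ?_
  intro X _ _ _ _ _ _ D _ e hdec haf hsrc hsole hE
  obtain ⟨N, Y, hN, hY, hDY, hdN, hG, hN0, -⟩ := hA X D e hdec haf hsrc hsole hE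
  have hc : D.IsComplete := AFEnd.isComplete_of_isAsymptoticallyFlat_of_isSoleEnd one_pos haf hsole
  exact D.simplyConnectedSpace_of_kids_of_far_balls N Y hN hY hDY hdN hG hN0 hc fun ρ ↦
    AFEnd.exists_far_loopTrivial_ball one_pos haf ρ

end Literature.Geometry.Lorentzian

end
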